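import Literature.MathematicalPhysics.QuantumFieldTheory.Balaban1983to89.B9Eq3152ProjGreenPrimeGradRowClosed
import Literature.MathematicalPhysics.QuantumFieldTheory.Balaban1983to89.B9Eq315QTowerFlat
import Literature.MathematicalPhysics.QuantumFieldTheory.Balaban1983to89.B9Eq326OperatorTowerFlat
import HarnessLib

/-!
# Route `UnitScaleTilt`, crux K1 «MinimiserStabilityRegPr» (stmt-QuantumFields-19200), stub `stub_existenceMinimalOrbit` (EX) — N06 print row `hPcol` of the EX display
# (S34ᴸ ✓p715121 ll.218–223), FLAT-CERTIFICATE ROAD «hPcol(1)», FILE 2∕4 «FLAT TOWER DATUM»: **THE GRADIENT ROW OF THE TRANSPOSED WORD `D_1∘R_k(1)∘G′_k(1)` AT THE FLAT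
# TOWER BACKGROUND `U ≡ 1`, `∃ (B, δ)` BEFORE THE HEIGHT, WITH EVERY WINDOW BINDER OF lit (T2) ✓`B9Eq3152ProjGreenPrimeGradRowClosed.exists_local_gradLetter_RkGp` DISCHARGED
# BY NAME** — [Balaban1985BackgroundPropagators] (3.42)+(3.25) at `U = 1`, the sup-row letter which FILE 4 turns, by duality, into the ℓ¹ column of `G′_kR_kD_1†` on a one-bond
# source ([Balaban1985Variational] p.299 l.6 «`G′RD*` is a bounded operator in the norm `|·|₍₁₎`», read as the EX display's (P-ℓ¹) row; memo `LOCATE-HPCOL-FLATCERT-px20g7.md` §3)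

Cell `ym3-torus`, width seat `ym3-torus-px20` (gen 7); the twin of px20 g6's ✓`Prop7TowerDPDstarPointRowFlat.exists_pointRow_DPDstar_tower_one` for this road (FILE 1 of this road IS the
landed lit (T2) — nothing re-typed).  THEOREMS ONLY (0 `def`, 0 `sorry`); `--supports stmt-QuantumFields-19200 --as helper`, count-neutral.  YM₃ on T³ is a ladder rung (R3), not the
Clay problem; nothing here claims the displayed row `hPcol` (curved `U₀ ∈ RegPr`, N06 — ★★OWNER WORD 14), (139), the stub, the crux or the mass gap.

WHAT IS PROVED (ns `Summit.QuantumFields.YangMills.Theorems.Prop7TowerRkGpkGradRowFlat`; [folklore] instantiation of lit ✓`exists_local_gradLetter_RkGp` at the constant background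
`fun _ ↦ 1`): ★★★`exists_gradRow_RkGpk_one` — `∃ B δ`, `0 ≤ B`, `0 < δ`, such that for every height `n`, spacing `η` with `ηL^{n+1} = 1`, weights on the diagonal `c₀(L^{n+1})^d = c₁`
with `|η|^d∕c₀ ≤ ρw`, period `m`, ANY positivity witness `hpos′` of `Δ′_{a′,k}(1)` (inhabited: lit ✓`laplacePrimeAk_one_pos`), every coarse block `v`, every site field `w` supported over
`Π⁻¹(v)` with `‖w‖_∞ ≤ F`, and every fine bond `b`: `‖(D_1(R_k(1)(G′_k(1) w)))(b)‖ ≤ B·e^{−δ·d_m(Π(b₊), v)}·F`.  The window binders at `U := 1`, `α := 0`, `αU = εU := 0`,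
`ϱ := 0`, `AQ := 0`, `a := 1`: `hU1` ✓`B9Eq315QTowerFlat.perCfg_UlevOf_one_mem_U1`, `hreg` ✓`norm_Wcx_UlevOf_one_sub_one_le`, `hUε hLb hRlev` by ✓`UlevOf_one`, `hUst hUb hUη hUgrad hεg hAQ`
trivial at `1`, `hpl` ✓`plaqHolU_one` — EXACTLY as px20 g6's FILE 2.
HONEST SCOPE.  Instantiation only; constants `B δ` depend on `(d, L, a′, M_φ, M_φ′, C_τ, M_τ, ρ_w)`; nothing of (3.42)∕(3.25) at curved backgrounds is discharged here; rung R3, not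
Clay; YM gap NOT proved.

References: T. Bałaban, CMP **99** (1985) 389–434 [Balaban1985BackgroundPropagators] ((3.25) p.394, (3.41)–(3.42) p.397, (3.152) p.426, Thm 3.11 p.416); CMP **102** (1985) 277–309
[Balaban1985Variational] (p.299 l.6); CMP **98** (1985) 17–51 [Balaban1985Averaging] ((42)–(43) pp.23–24).
-/

noncomputable section

set_option autoImplicit false
open scoped InnerProductSpace ComplexConjugate BigOperators

namespace Summit.QuantumFields.YangMills.Theorems.Prop7TowerRkGpkGradRowFlat

open Literature.MathematicalPhysics.QuantumFieldTheory.Balaban1983to89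
open B4Sect5Torus (TSite tdist)
open B9SectCLatticeCarrier (Bond btgt unshift)
open B9Eq311L2Pairing (WL2)
open B9Eq319QprimeTorus (blockCoord)
open B7Prop1Explicit (U1)
open B11Eq103H1Complex (SiteL2K BondL2K covDerivL2K)
open B9Eq310DeltaPrime (plaqHolU plaqHolU_one)
open B9Eq310HessianOperator (adTransportW adTransportW_apply)
open B9Eq315QTower (towerP UlevOf)
open B9Eq315QTowerFlat (UlevOf_one perCfg_UlevOf_one_mem_U1 norm_Wcx_UlevOf_one_sub_one_le)
open B9Eq316TowerFlatIsOneStep (towerP_eq_fineP_pow siteCast)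
open B9Eq326OperatorTower (RofUk)
open B9Eq324DeltaPrimeATower (laplacePrimeAk GpOfUk)
open B9Eq3152ProjGreenPrimeGradRowClosed (exists_local_gradLetter_RkGp)

variable {d : ℕ} (hd : 1 ≤ d) (L : ℕ) [NeZero L] (hL : 1 ≤ L) (hL3 : 3 ≤ L)
  {𝔸 : Type*} [NormedRing 𝔸] [NormedAlgebra ℂ 𝔸] [CompleteSpace 𝔸] [NormOneClass 𝔸] [StarRing 𝔸] [NormedStarGroup 𝔸] [StarModule ℂ 𝔸]
  {W : Type*} [NormedAddCommGroup W] [InnerProductSpace ℂ W] [FiniteDimensional ℂ W] (φ : W ≃ₗ[ℂ] 𝔸)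
  {Mφ Mφ' : ℝ} (hMφ : 0 ≤ Mφ) (hMφ' : 0 ≤ Mφ') (hφ : ∀ w, ‖φ w‖ ≤ Mφ * ‖w‖) (hφ' : ∀ X, ‖φ.symm X‖ ≤ Mφ' * ‖X‖)
  {a' : ℝ} (ha' : 0 < a')
  (τ : 𝔸 →ₗ[ℂ] ℂ) {Cτ : ℝ} (hτ : ∀ X, ‖τ X‖ ≤ Cτ * ‖X‖) (hCτ : 0 ≤ Cτ) {Mτ : ℝ} (hMτ : 0 ≤ Mτ) {ρw : ℝ} (hρw : 0 ≤ ρw)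
  (hτ₁ : ∀ X : 𝔸, τ (star X) = conj (τ X)) (hτ₂ : ∀ X Y : 𝔸, τ (X * Y) = τ (Y * X)) (hφτ : ∀ X Y : 𝔸, ⟪φ.symm X, φ.symm Y⟫_ℂ = τ (star X * Y))

include hd hL hL3 hMφ hMφ' hφ hφ' ha' hτ hCτ hMτ hρw hτ₁ hτ₂ hφτ in
/-- ★★★ **THE GRADIENT ROW OF `D_1∘R_k(1)∘G′_k(1)` AT THE FLAT TOWER BACKGROUND `U ≡ 1`, `∃ (B, δ)` BEFORE THE HEIGHT**: for every `n`, `η` with `ηL^{n+1} = 1`, weights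
`c₀(L^{n+1})^d = c₁` with `|η|^d∕c₀ ≤ ρw`, period `m`, any positivity witness `hpos′` of `Δ′_{a′,k}(1)`, every coarse block `v`, every site field `w` supported over `Π⁻¹(v)` with
`‖w‖_∞ ≤ F`, and every fine bond `b`: `‖(D_1(R_k(1)(G′_k(1) w)))(b)‖ ≤ B·e^{−δ·d_m(Π(b₊), v)}·F` — lit ✓`exists_local_gradLetter_RkGp` at `U := 1` with every window binder discharged by
the flat tower dictionary (`UlevOf_one`, `perCfg_UlevOf_one_mem_U1`, `norm_Wcx_UlevOf_one_sub_one_le`, `plaqHolU_one`).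
[cite: Balaban1985BackgroundPropagators, (3.25) p.394, Thm 3.1 (3.42) p.397, (3.152) p.426, Thm 3.11 p.416; Balaban1985Variational, p.299 l.6] -/
theorem exists_gradRow_RkGpk_one :
    ∃ B δ : ℝ, 0 ≤ B ∧ 0 < δ ∧
      ∀ (n : ℕ) (η : ℝ) (_hηL : η * (L : ℝ) ^ (n + 1) = 1) (c₀ c₁ : ℝ) [Fact (0 < c₀)] [Fact (0 < c₁)]
        (_hw : c₀ * ((L : ℝ) ^ (n + 1)) ^ d = c₁) (_hρ : |η| ^ d / c₀ ≤ ρw) (m : Fin d → ℕ) [∀ i, NeZero (m i)] (_hm : ∀ i, 1 ≤ m i)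
        (hpos' : ∀ x : SiteL2K ℂ d (towerP L m (n + 1)) c₀ W, x ≠ 0 →
          0 < RCLike.re ⟪x, laplacePrimeAk L m n φ η (fun _ : Bond d (towerP L m (n + 1)) => (1 : 𝔸ˣ)) a' (c₁ := c₁) x⟫_ℂ)
        (v : TSite d m) (w : SiteL2K ℂ d (towerP L m (n + 1)) c₀ W) (F : ℝ)
        (_hwv : ∀ x, blockCoord (L ^ (n + 1)) m (siteCast (towerP_eq_fineP_pow L m (n + 1)) x) ≠ v →
          WL2.equiv ℂ (fun _ : TSite d (towerP L m (n + 1)) => c₀) W w x = 0)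
        (_hwF : ∀ x, ‖WL2.equiv ℂ (fun _ : TSite d (towerP L m (n + 1)) => c₀) W w x‖ ≤ F) (b : Bond d (towerP L m (n + 1))),
        ‖WL2.equiv ℂ (fun _ : Bond d (towerP L m (n + 1)) => c₀) W
            (covDerivL2K ℂ c₀ ((η : ℂ))⁻¹ (adTransportW φ (fun _ : Bond d (towerP L m (n + 1)) => (1 : 𝔸ˣ)))
              (RofUk L m n φ η (fun _ : Bond d (towerP L m (n + 1)) => (1 : 𝔸ˣ)) (c₀ := c₀)
                (GpOfUk L m n φ η (fun _ : Bond d (towerP L m (n + 1)) => (1 : 𝔸ˣ)) a' (c₁ := c₁) hpos' w))) b‖ ≤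
          B * Real.exp (-(δ * tdist m (blockCoord (L ^ (n + 1)) m (siteCast (towerP_eq_fineP_pow L m (n + 1)) (btgt b))) v)) * F := by
  obtain ⟨α₁, B, δ, hα₁, hB, hδ, H⟩ := exists_local_gradLetter_RkGp hd L hL hL3 φ hMφ hMφ' hφ hφ' (a := 1) one_pos ha' (ϱ := 0) le_rfl one_pos
    τ hτ hCτ hMτ hρw hτ₁ hτ₂ hφτ 0
  refine ⟨B, δ, hB, hδ, ?_⟩
  intro n η hηL c₀ c₁ _ _ hw hρ m _ hm hpos' v w F hwv hwF b
  have h1U : ∀ (j : ℕ) (bb : Bond d (towerP L m (j + 1))),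
      UlevOf L m (n + 1) (fun _ : Bond d (towerP L m (n + 1)) => (1 : 𝔸ˣ)) j bb = 1 := fun j bb => by
    rw [UlevOf_one]
  exact H n η hηL c₀ c₁ hw hρ m hm (fun _ => 1) (fun _ => 0) (fun _ => le_rfl) (fun _ => by norm_num)
    (perCfg_UlevOf_one_mem_U1 L m (n + 1)) (norm_Wcx_UlevOf_one_sub_one_le L m (n + 1) (fun _ => 0) (fun _ => le_rfl))
    (fun _ => 0) (fun _ => le_rfl) (fun j bb => by rw [h1U, Units.val_one, sub_self, norm_zero])
    (fun j bb => by rw [h1U]; exact (U1 𝔸).one_mem) 0 le_rfl hα₁.le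
    (fun _ => by rw [Units.val_one, star_one, inv_one, Units.val_one]) (fun _ => (U1 𝔸).one_mem)
    (fun _ => by rw [Units.val_one, sub_self, norm_zero, zero_mul]) (fun p => by rw [plaqHolU_one, Units.val_one, sub_self, norm_zero, zero_mul])
    (fun x μ => by rw [sub_self, norm_zero, zero_mul])
    (fun j bb w => by rw [UlevOf_one]; simp [adTransportW_apply])
    (fun j _ => by rw [zero_mul]) (by simp) hpos' v w F hwv hwF b

end Summit.QuantumFields.YangMills.Theorems.Prop7TowerRkGpkGradRowFlat

end
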